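import Summits.MatrixMultiplication.OmegaCensus.STPPSmallPatternSquareProducts
import Summits.MatrixMultiplication.OmegaCensus.STPPSmallPatternLawBridge
import Summits.MatrixMultiplication.OmegaCensus.STPPPatternMonotonicity
import Summits.MatrixMultiplication.OmegaCensus.STPPSmallPatternOnsetLaws

/-!
# ω-census, small STPP patterns: the PRODUCT ROUTE for seed types (STPP × tricolored-sum-free set, cut, coordinate shuffle)

HONEST FRAMING (pub-omega census; verbatim): lottery ticket; floor = certified bounds/negative ranges.
Census STRUCTURE bookkeeping of the STPP track (seat pub-omega-stpp-3, gen 27; STRUCTURE row B5, column `T2`, §2 C10), not progress on `ω`: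
small patterns in small groups bound no exponent.

The seed types `ℤ/v₁ × ⋯ × ℤ/v_r` of an all-type `(1,2,2)^k` host law (`STPPSmallPatternLawBridge.lean`) are, for composite-friendly `k`,
almost all settled WITHOUT SEARCH: split the coordinates into `K` (carrying a tricolored sum-free set of size `t`, e.g.
`exists_isTSF_two_zmod`, `exists_isTSF_four_zmod_of_le9`, `exists_isTSF_six_zmod2_pow4`, `exists_isTSF_prod_of_le_card`, `exists_isTSF_mul`) and
`H` (hosting `(1,2,2)^N` by an already-landed all-abelian host law, `N = ⌈k/t⌉`); the tree's product `exists_isSTPP_cards_mul_of_tsf` gives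
`(1,2,2)^{N·t} ⊆ H × K`, which is cut to `k` triples and carried to the seed type by a coordinate shuffle.  This file packages exactly that:

* `exists_isSTPP_cards_prod_of_tsf_le` — `(a,b,c)^N ⊆ H`, a `t`-element TSF in `K`, `k ≤ N·t` ⇒ `(a,b,c)^k ⊆ K × H`;
* `exists_isSTPP_cards_prod_of_tsf_le_of_leftInverse` — the same transported along any additive map `K × H →+ G` with a left inverse
  (a coordinate shuffle onto the seed type; injectivity from the left inverse, no decision procedure).

Used by `STPPSmallPatternT2K12ProdSeeds*.lean` (307 of the 361 seed types of the `k = 12` law).  Nothing here is specific to `k = 12`.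

References: H. Cohn, R. Kleinberg, B. Szegedy, C. Umans, FOCS 2005 (arXiv:math/0511460), Def. 5.1; J. Blasiak, T. Church, H. Cohn, J. Grochow,
E. Naslund, W. Sawin, C. Umans, Discrete Analysis 2017:3, Def. 3.1 (tricolored sum-free sets).
-/

open Literature.Computability.AlgebraicComplexity Literature.Combinatorics.Additive Finset

namespace Summit.MatrixMultiplication.OmegaCensus

/-- **Product route:** an STPP family `(a,b,c)^N ⊆ H`, a tricolored sum-free set of size `t` in `K` and `k ≤ N·t` give `(a,b,c)^k ⊆ K × H`
(the product `exists_isSTPP_cards_mul_of_tsf` in `H × K`, swapped to `K × H` by `AddEquiv.prodComm`, cut to its first `k` triples).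
[cite: CohnKleinbergSzegedyUmans2005, Def. 5.1] -/
theorem exists_isSTPP_cards_prod_of_tsf_le {H K : Type*} [AddCommGroup H] [AddCommGroup K] {N t a b c : ℕ}
    (hH : ∃ A B C : Fin N → Finset H, IsSTPP A B C ∧ ∀ i, (A i).card = a ∧ (B i).card = b ∧ (C i).card = c)
    (hK : ∃ σ τ υ : Fin t → K, IsTricoloredSumFree σ τ υ) (k : ℕ) (hk : k ≤ N * t) :
    ∃ A B C : Fin k → Finset (K × H), IsSTPP A B C ∧ ∀ i, (A i).card = a ∧ (B i).card = b ∧ (C i).card = c := by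
  obtain ⟨σ, τ, υ, hT⟩ := hK
  have h := exists_isSTPP_cards_of_injective (AddEquiv.prodComm (M := H) (N := K)).toAddMonoidHom
    (AddEquiv.prodComm (M := H) (N := K)).injective (exists_isSTPP_cards_mul_of_tsf hH hT)
  exact exists_isSTPP_of_embedding (fun _ => a) (fun _ => b) (fun _ => c) (fun _ => a) (fun _ => b) (fun _ => c)
    (Fin.castLE hk) (Fin.castLE_injective hk) (fun _ => le_rfl) (fun _ => le_rfl) (fun _ => le_rfl) h

/-- **Product route, transported:** as `exists_isSTPP_cards_prod_of_tsf_le`, followed by an additive map `φ : K × H →+ G` that has a left inverse `ψ`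
(hence is injective) — in the applications `φ` is a coordinate shuffle onto a seed type `ℤ/v₁ × ⋯ × ℤ/v_r` and `ψ ∘ φ = id` holds by `rfl`.
[cite: CohnKleinbergSzegedyUmans2005, Def. 5.1] -/
theorem exists_isSTPP_cards_prod_of_tsf_le_of_leftInverse {H K G : Type*} [AddCommGroup H] [AddCommGroup K] [AddCommGroup G]
    {N t a b c : ℕ}
    (hH : ∃ A B C : Fin N → Finset H, IsSTPP A B C ∧ ∀ i, (A i).card = a ∧ (B i).card = b ∧ (C i).card = c)
    (hK : ∃ σ τ υ : Fin t → K, IsTricoloredSumFree σ τ υ) (k : ℕ) (hk : k ≤ N * t)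
    (φ : K × H →+ G) (ψ : G → K × H) (hψ : Function.LeftInverse ψ φ) :
    ∃ A B C : Fin k → Finset G, IsSTPP A B C ∧ ∀ i, (A i).card = a ∧ (B i).card = b ∧ (C i).card = c :=
  exists_isSTPP_cards_of_injective φ hψ.injective (exists_isSTPP_cards_prod_of_tsf_le hH hK k hk)

/-- Worked instance of the transported route (and a regression test of the `rfl` shuffle): **`(1,2,2)¹² ⊆ ℤ/5 × ℤ/4 × ℤ/4 × ℤ/3`** from
`(1,2,2)² ⊆ ℤ/5 × ℤ/3` (order `15 ≥ 12`, onset law) and the 6-element TSF of `(ℤ/4)²`, shuffled into the seed order `(5, 4, 4, 3)`.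
[cite: CohnKleinbergSzegedyUmans2005, Def. 5.1] -/
theorem exists_isSTPP_122pow12_seed_5_4_4_3 :
    ∃ A B C : Fin 12 → Finset (ZMod 5 × ZMod 4 × ZMod 4 × ZMod 3), IsSTPP A B C ∧ ∀ i, (A i).card = 1 ∧ (B i).card = 2 ∧ (C i).card = 2 :=
  exists_isSTPP_cards_prod_of_tsf_le_of_leftInverse (H := ZMod 5 × ZMod 3) (K := ZMod 4 × ZMod 4)
    (exists_isSTPP_122pow2_of_card_ge_12 (G := ZMod 5 × ZMod 3) (by simp)) exists_isTSF_six_zmod4_sq 12 (by norm_num)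
    (AddMonoidHom.mk' (fun x => (x.2.1, x.1.1, x.1.2, x.2.2)) (fun _ _ => rfl))
    (fun y => ((y.2.1, y.2.2.1), (y.1, y.2.2.2))) (fun _ => rfl)

end Summit.MatrixMultiplication.OmegaCensus
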